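import Summits.Ventures.CertifiedManyBodySolver.Rows.DopedTLCorr

/-!
# SIGN-THRESHOLD correlator rows on the `t–t'` square lattice: the energy level below which a
# correlator SIGN is forced, typed as the tangent family of the tree's window rows

HONEST FRAMING: first certified bounds; not a superconductivity verdict; every number certified or
labelled float.

WHAT THIS FILE IS (sr-mbsolver-m3-7, M3 stripe / structure-factor seat; STRETCH-ORDER lane). A
formulation-A moment relaxation of the thermodynamic-limit `t–t'` Hubbard model (translation-invariant,
lattice-symmetric, `H`-stationary pseudo-states) certifies, for a local correlator word `X ∈ 𝔄_Λ` and an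
event boundary `r`, an ENERGY THRESHOLD: minimise the energy density over the relaxation subject to the
ONE half-space hypothesis `Re ω(X) ≤ r` (the complement of the sign event `r < Re ω(X)`); the dual
certificate of that programme, with multiplier `λ > 0` on the hypothesis row, is — after division by
`λ` — EXACTLY the window-certificate identity of
`InfVolFermionState.IsTorusLimitOf.re_expect_ge_of_window_certificate_TT'_ineq` with energy multiplier
`κ = 1/λ` and constant `c(u) = r + κ (E − u)` at EVERY cap `u`. So a threshold certificate is not a new
kind of object: it is the one-parameter FAMILY of the existing rows
`SquareTTPrimeCorrLowerRow tp U n u (r + κ (E − u)) Λ X`, `u ∈ ℚ` (the supporting line of the concave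
value function `u ↦ sup {Re ω(X) : e(ω) ≤ u}` at its contact point `u = E`), and `E` is the cap at
which the line meets the event boundary. This file types that family (`…ThresholdLowerRow`,
`…ThresholdUpperRow`, and the M3′ cells at `U = 8`, `n = 7/8`) and proves the solver-free edges a
reader needs:

* at the threshold cap the family member IS the plain row with bound `r`
  (`…ThresholdLowerRow.lowerRow_at_threshold`);
* MODUS PONENS (the point of the row): if the true energy density is STRICTLY below the threshold,
  `energyDensityTT' 1 tp U n < E`, and `κ > 0`, then EVERY torus limit of unit sector ground states
  satisfies the STRICT sign event `r < Re ω(X)` (`…ThresholdLowerRow.re_expect_gt`; upper form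
  `…ThresholdUpperRow.re_expect_lt`); at the M3′ point the energy hypothesis is discharged by a typed
  `M3EnergyUpperRow tp hi` with `hi < E` (`M3CorrThresholdLowerRow.re_expect_gt_uncond`) — a sign row
  that is never re-priced when the energy upper bound of record moves: one comparison `hi < E`;
* upper thresholds from lower thresholds of `−X`, and monotonicity in the slots.

NOTHING IS ASSERTED HERE: every bound-valued statement is a `def … : Prop` or takes row predicates as
hypotheses; instances come only from certificate files through the named soundness theorem (one
`SquareTTPrimeCorrLowerRow` instance per rational cap, or the family at once). No `sorry`, no new
axiom, no named fact. Method as printed: the windowed-observable programme of Wang et al. 2024 §III /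
Han 2020 §3 read along the energy axis (parametric duality); design note
`HOME/sr-mbsolver-m3-7/jobs/sthr/JOB.md` §0–§0b.
-/

noncomputable section

namespace Summit.Ventures.CertifiedManyBodySolver

open Literature.MathematicalPhysics.QuantumLattice
open Matrix HubbardWave0 Literature.Probability.LatticeModels ThermodynamicLimit Filter Topology
open scoped BigOperators

section Square

variable {tp U n : ℝ} {E E' r r' κ κ' : ℚ} {Λ : Finset (Site 2)} {X : FermionOp Λ}

/-- SIGN-THRESHOLD row, LOWER form (`t = 1`, NNN hopping `tp`, coupling `U`, density `n`; threshold
`E`, event boundary `r`, energy multiplier `κ`): for EVERY rational cap `u`, the window row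
"GIVEN `energyDensityTT' 1 tp U n ≤ u`, `r + κ (E − u) ≤ Re ω(X)` for every torus limit `ω` of unit
sector ground states" — the tangent family of a threshold certificate (module docstring). -/
def SquareTTPrimeCorrThresholdLowerRow (tp U n : ℝ) (E r κ : ℚ) (Λ : Finset (Site 2))
    (X : FermionOp Λ) : Prop :=
  ∀ u : ℚ, SquareTTPrimeCorrLowerRow tp U n u (r + κ * (E - u)) Λ X

/-- SIGN-THRESHOLD row, UPPER form: for every rational cap `u`, GIVEN `energyDensityTT' 1 tp U n ≤ u`,
`Re ω(X) ≤ r − κ (E − u)`. -/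
def SquareTTPrimeCorrThresholdUpperRow (tp U n : ℝ) (E r κ : ℚ) (Λ : Finset (Site 2))
    (X : FermionOp Λ) : Prop :=
  ∀ u : ℚ, SquareTTPrimeCorrUpperRow tp U n u (r - κ * (E - u)) Λ X

/-- The family member at cap `u`. -/
theorem SquareTTPrimeCorrThresholdLowerRow.lowerRow
    (h : SquareTTPrimeCorrThresholdLowerRow tp U n E r κ Λ X) (u : ℚ) :
    SquareTTPrimeCorrLowerRow tp U n u (r + κ * (E - u)) Λ X := h u

/-- The family member at cap `u` (upper form). -/
theorem SquareTTPrimeCorrThresholdUpperRow.upperRow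
    (h : SquareTTPrimeCorrThresholdUpperRow tp U n E r κ Λ X) (u : ℚ) :
    SquareTTPrimeCorrUpperRow tp U n u (r - κ * (E - u)) Λ X := h u

/-- At the threshold cap `u = E` the family member is the PLAIN lower row with bound `r`. -/
theorem SquareTTPrimeCorrThresholdLowerRow.lowerRow_at_threshold
    (h : SquareTTPrimeCorrThresholdLowerRow tp U n E r κ Λ X) :
    SquareTTPrimeCorrLowerRow tp U n E r Λ X := by
  have hh := h E
  simp only [sub_self, mul_zero, add_zero] at hh
  exact hh

/-- At the threshold cap `u = E` the family member is the PLAIN upper row with bound `r`. -/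
theorem SquareTTPrimeCorrThresholdUpperRow.upperRow_at_threshold
    (h : SquareTTPrimeCorrThresholdUpperRow tp U n E r κ Λ X) :
    SquareTTPrimeCorrUpperRow tp U n E r Λ X := by
  have hh := h E
  simp only [sub_self, mul_zero, sub_zero] at hh
  exact hh

/-- UPPER thresholds from LOWER thresholds on the negated objective (linearity of `ω.expect`). -/
theorem SquareTTPrimeCorrThresholdUpperRow.of_lower_neg
    (h : SquareTTPrimeCorrThresholdLowerRow tp U n E (-r) κ Λ (-X)) :
    SquareTTPrimeCorrThresholdUpperRow tp U n E r κ Λ X := by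
  intro u
  have hh := h u
  have he : -r + κ * (E - u) = -(r - κ * (E - u)) := by ring
  rw [he] at hh
  exact SquareTTPrimeCorrUpperRow.of_lower_neg hh

/-- LOWER thresholds from UPPER thresholds on the negated objective. -/
theorem SquareTTPrimeCorrThresholdLowerRow.of_upper_neg
    (h : SquareTTPrimeCorrThresholdUpperRow tp U n E (-r) κ Λ (-X)) :
    SquareTTPrimeCorrThresholdLowerRow tp U n E r κ Λ X := by
  intro u
  have hh := h u
  have he : -r - κ * (E - u) = -(r + κ * (E - u)) := by ring
  rw [he] at hh
  exact SquareTTPrimeCorrLowerRow.of_upper_neg hh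

/-- Monotonicity of a lower threshold row: a smaller threshold `E' ≤ E` (with `0 ≤ κ`) and a smaller
event boundary `r' ≤ r` are weaker claims. -/
theorem SquareTTPrimeCorrThresholdLowerRow.mono
    (h : SquareTTPrimeCorrThresholdLowerRow tp U n E r κ Λ X) (hκ : 0 ≤ κ) (hE : E' ≤ E)
    (hr : r' ≤ r) : SquareTTPrimeCorrThresholdLowerRow tp U n E' r' κ Λ X := by
  intro u
  refine (h u).mono le_rfl ?_
  nlinarith [mul_le_mul_of_nonneg_left (sub_le_sub_right hE u) hκ]

/-- Monotonicity of an upper threshold row (`E' ≤ E`, `0 ≤ κ`, `r ≤ r'`). -/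
theorem SquareTTPrimeCorrThresholdUpperRow.mono
    (h : SquareTTPrimeCorrThresholdUpperRow tp U n E r κ Λ X) (hκ : 0 ≤ κ) (hE : E' ≤ E)
    (hr : r ≤ r') : SquareTTPrimeCorrThresholdUpperRow tp U n E' r' κ Λ X := by
  intro u
  refine (h u).mono le_rfl ?_
  nlinarith [mul_le_mul_of_nonneg_left (sub_le_sub_right hE u) hκ]

/-- **MODUS PONENS (lower form).** A lower threshold row with `κ > 0` and the true energy density
STRICTLY below the threshold force the STRICT sign event `r < Re ω(X)` on every torus limit `ω` of unit
ground states of the sectors `(rectN n L_j, S^z = 0)` of `hubbardTorusTT' L_j 1 tp U`, `L_j → ∞`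
(pick a rational cap `u` with `e ≤ u < E`; the family member at `u` has bound `r + κ (E − u) > r`). -/
theorem SquareTTPrimeCorrThresholdLowerRow.re_expect_gt
    (h : SquareTTPrimeCorrThresholdLowerRow tp U n E r κ Λ X) (hκ : 0 < κ)
    (he : energyDensityTT' 1 tp U n < ((E : ℚ) : ℝ)) :
    ∀ (ω : InfVolFermionState 2) (Ls : ℕ → ℕ) (ψ : ∀ L, Fock (Orb (FermionTorus 2 L))),
      Tendsto Ls atTop atTop →
      (∀ j, IsGroundStateInSector (hubbardTorusTT' (Ls j) 1 tp U) (rectN n (Ls j)) 0 (ψ (Ls j))) →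
      (∀ j, star (ψ (Ls j)) ⬝ᵥ ψ (Ls j) = 1) → ω.IsTorusLimitOf ψ Ls →
      ((r : ℚ) : ℝ) < (ω.expect Λ X).re := by
  intro ω Ls ψ hLs hψ hψ1 hω
  obtain ⟨u, heu, huE⟩ := exists_rat_btwn he
  have hh := h u ω Ls ψ hLs hψ hψ1 hω heu.le
  have huE' : u < E := by exact_mod_cast huE
  have hlt : r < r + κ * (E - u) := lt_add_of_pos_right r (mul_pos hκ (sub_pos.2 huE'))
  exact lt_of_lt_of_le (by exact_mod_cast hlt) hh

/-- **MODUS PONENS (upper form)**: `κ > 0` and `energyDensityTT' 1 tp U n < E` force the strict event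
`Re ω(X) < r` on every torus-limit ground state. -/
theorem SquareTTPrimeCorrThresholdUpperRow.re_expect_lt
    (h : SquareTTPrimeCorrThresholdUpperRow tp U n E r κ Λ X) (hκ : 0 < κ)
    (he : energyDensityTT' 1 tp U n < ((E : ℚ) : ℝ)) :
    ∀ (ω : InfVolFermionState 2) (Ls : ℕ → ℕ) (ψ : ∀ L, Fock (Orb (FermionTorus 2 L))),
      Tendsto Ls atTop atTop →
      (∀ j, IsGroundStateInSector (hubbardTorusTT' (Ls j) 1 tp U) (rectN n (Ls j)) 0 (ψ (Ls j))) →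
      (∀ j, star (ψ (Ls j)) ⬝ᵥ ψ (Ls j) = 1) → ω.IsTorusLimitOf ψ Ls →
      (ω.expect Λ X).re < ((r : ℚ) : ℝ) := by
  intro ω Ls ψ hLs hψ hψ1 hω
  obtain ⟨u, heu, huE⟩ := exists_rat_btwn he
  have hh := h u ω Ls ψ hLs hψ hψ1 hω heu.le
  have huE' : u < E := by exact_mod_cast huE
  have hlt : r - κ * (E - u) < r := sub_lt_self r (mul_pos hκ (sub_pos.2 huE'))
  exact lt_of_le_of_lt hh (by exact_mod_cast hlt)

/-- The NON-STRICT event at the threshold itself: `energyDensityTT' 1 tp U n ≤ E` gives `r ≤ Re ω(X)`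
(no sign of `κ` needed). -/
theorem SquareTTPrimeCorrThresholdLowerRow.re_expect_ge
    (h : SquareTTPrimeCorrThresholdLowerRow tp U n E r κ Λ X)
    (he : energyDensityTT' 1 tp U n ≤ ((E : ℚ) : ℝ)) :
    ∀ (ω : InfVolFermionState 2) (Ls : ℕ → ℕ) (ψ : ∀ L, Fock (Orb (FermionTorus 2 L))),
      Tendsto Ls atTop atTop →
      (∀ j, IsGroundStateInSector (hubbardTorusTT' (Ls j) 1 tp U) (rectN n (Ls j)) 0 (ψ (Ls j))) →
      (∀ j, star (ψ (Ls j)) ⬝ᵥ ψ (Ls j) = 1) → ω.IsTorusLimitOf ψ Ls →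
      ((r : ℚ) : ℝ) ≤ (ω.expect Λ X).re :=
  fun ω Ls ψ hLs hψ hψ1 hω => h.lowerRow_at_threshold ω Ls ψ hLs hψ hψ1 hω he

/-! ### The M3′ cells (`U = 8`, `n = 7/8`; `tp ∈ {0, −1/4}`) -/

/-- M3′ SIGN-THRESHOLD lower cell at the canonical point. -/
def M3CorrThresholdLowerRow (tp : ℝ) (E r κ : ℚ) (Λ : Finset (Site 2)) (X : FermionOp Λ) : Prop :=
  SquareTTPrimeCorrThresholdLowerRow tp 8 (7 / 8) E r κ Λ X

/-- M3′ SIGN-THRESHOLD upper cell at the canonical point. -/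
def M3CorrThresholdUpperRow (tp : ℝ) (E r κ : ℚ) (Λ : Finset (Site 2)) (X : FermionOp Λ) : Prop :=
  SquareTTPrimeCorrThresholdUpperRow tp 8 (7 / 8) E r κ Λ X

/-- Each family member of an M3′ threshold cell is an M3′ correlator cell (`M3CorrLowerRow`). -/
theorem M3CorrThresholdLowerRow.m3CorrLowerRow (h : M3CorrThresholdLowerRow tp E r κ Λ X) (u : ℚ) :
    M3CorrLowerRow tp u (r + κ * (E - u)) Λ X := h u

/-- Upper form. -/
theorem M3CorrThresholdUpperRow.m3CorrUpperRow (h : M3CorrThresholdUpperRow tp E r κ Λ X) (u : ℚ) :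
    M3CorrUpperRow tp u (r - κ * (E - u)) Λ X := h u

/-- **UNCONDITIONAL STRICT SIGN at the M3′ point (lower form).** A threshold cell with `κ > 0` and a
typed energy UPPER row `M3EnergyUpperRow tp hi` (`Statement.lean`) with `hi < E` give `r < Re ω(X)`
for EVERY torus limit of unit sector ground states — the sign row is settled by ONE comparison of
rationals, whatever method produced `hi`. -/
theorem M3CorrThresholdLowerRow.re_expect_gt_uncond (h : M3CorrThresholdLowerRow tp E r κ Λ X)
    (hκ : 0 < κ) {hi : ℚ} (hE : M3EnergyUpperRow tp hi) (hhi : hi < E) :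
    ∀ (ω : InfVolFermionState 2) (Ls : ℕ → ℕ) (ψ : ∀ L, Fock (Orb (FermionTorus 2 L))),
      Tendsto Ls atTop atTop →
      (∀ j, IsGroundStateInSector (hubbardTorusTT' (Ls j) 1 tp 8) (rectN (7 / 8) (Ls j)) 0 (ψ (Ls j))) →
      (∀ j, star (ψ (Ls j)) ⬝ᵥ ψ (Ls j) = 1) → ω.IsTorusLimitOf ψ Ls →
      ((r : ℚ) : ℝ) < (ω.expect Λ X).re :=
  SquareTTPrimeCorrThresholdLowerRow.re_expect_gt h hκ
    (lt_of_le_of_lt (show energyDensityTT' 1 tp 8 (7 / 8) ≤ ((hi : ℚ) : ℝ) from hE)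
      (by exact_mod_cast hhi))

/-- **UNCONDITIONAL STRICT SIGN at the M3′ point (upper form)**: `Re ω(X) < r`. -/
theorem M3CorrThresholdUpperRow.re_expect_lt_uncond (h : M3CorrThresholdUpperRow tp E r κ Λ X)
    (hκ : 0 < κ) {hi : ℚ} (hE : M3EnergyUpperRow tp hi) (hhi : hi < E) :
    ∀ (ω : InfVolFermionState 2) (Ls : ℕ → ℕ) (ψ : ∀ L, Fock (Orb (FermionTorus 2 L))),
      Tendsto Ls atTop atTop →
      (∀ j, IsGroundStateInSector (hubbardTorusTT' (Ls j) 1 tp 8) (rectN (7 / 8) (Ls j)) 0 (ψ (Ls j))) →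
      (∀ j, star (ψ (Ls j)) ⬝ᵥ ψ (Ls j) = 1) → ω.IsTorusLimitOf ψ Ls →
      (ω.expect Λ X).re < ((r : ℚ) : ℝ) :=
  SquareTTPrimeCorrThresholdUpperRow.re_expect_lt h hκ
    (lt_of_le_of_lt (show energyDensityTT' 1 tp 8 (7 / 8) ≤ ((hi : ℚ) : ℝ) from hE)
      (by exact_mod_cast hhi))

/-- CONSISTENCY WITH THE ENERGY ROWS (non-vacuity of the state class,
`SquareTTPrimeCorrLowerRow.le_of_upperRow`): a lower threshold `(E, r, κ)` with `κ > 0` and a plain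
UPPER cell `Re ω(X) ≤ r` at some cap `u` that the true energy density obeys force `E ≤ u` — a
certified threshold can never lie strictly above a cap at which the complementary bound is certified. -/
theorem SquareTTPrimeCorrThresholdLowerRow.threshold_le_of_upperRow
    (h : SquareTTPrimeCorrThresholdLowerRow tp U n E r κ Λ X) (hκ : 0 < κ) {u : ℚ}
    (hu' : SquareTTPrimeCorrUpperRow tp U n u r Λ X) (hn0 : 0 ≤ n) (hn2 : n ≤ 2)
    (he : energyDensityTT' 1 tp U n ≤ ((u : ℚ) : ℝ)) : E ≤ u := by
  have hle := SquareTTPrimeCorrLowerRow.le_of_upperRow (h u) hu' hn0 hn2 he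
  by_contra hEu
  have hlt : u < E := lt_of_not_ge hEu
  have : r < r + κ * (E - u) := lt_add_of_pos_right r (mul_pos hκ (sub_pos.2 hlt))
  exact absurd hle (not_le.2 this)

end Square

end Summit.Ventures.CertifiedManyBodySolver
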